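import Mathlib
import Summits.PneNP.PneNP.Theorems.ConvexRankGatesConvexGateBlindXorDefs

/-!
# PneNP / ConvexRankGates — `ConvexGateBlind`, line `xor-door-perfect-completeness`: the embedding

Helper file for the crux `ConvexGateBlind` (item `stmt-PneNP-10680`, `--supports`; closes nothing by
itself). It proves the stub `stub_embedding` of the line,

  `ExactLifting → PerfectCompleteness → XorConeRankHardEv` :

ε-exact lifting for the Index gadget plus one perfect-completeness instance per degree give the
canonical cone-rank form of `C⁺` (eventually in `n`, no `(PSD_q ⊕ ℝ^r_{≥0})`-factorisation with
`q + r ≤ n^c` of the shifted one-sided distance matrix `#(v ∖ u) - ε` of `3XOR-UNSAT_n`).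

**Proof (XOR ∘ Index = XOR).** Fix `c`; pick a degree `d` with `c + 1 ≤ φ d` (`φ` is unbounded),
the unsatisfiable instance `F` on `m` variables fooled at degree `d` (`PerfectCompleteness`;
`m ≥ 1` since a system on `0` variables is satisfiable) and the threshold `T` of `ExactLifting` for
`(m, d, F)`. For `n ≥ (T + (2m)^c + 1) · m` put `t := n / m`, so that `T ≤ t`, `(2m)^c < t` and
`m · t ≤ n`. The lifted matrix `(x, w) ↦ viol_F(x[w]) - ε` (`x : Fin m → Fin t → 𝔽₂`,
`w : Fin m → Fin t`) is a SUBMATRIX of the big matrix of `XorConeRankHard n c`: embed the `m · t`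
gadget variables as `m` blocks of `t` variables of `Fin n` (`StubEmbedding.exists_blockEmb`, `ι`);
the row of `x` is the set of ALL pool equations satisfied by the `0`-extension `x̃` of `x` along
`ι` (a satisfiable system, `StubEmbedding.xor3Unsat_decide_sat`); the column of `w` is the renamed
copy `F_w` of `F`, variable `i ↦ ι (i, w i)` (unsatisfiable: a solution of `F_w` pulls back to a
solution of `F`, `StubEmbedding.xor3Unsat_decide_mem_map`); and
`#(F_w ∖ row x) = #{e ∈ F | x̃ violates the renamed e} = viol_F(x[w])` because
`x̃ (ι (i, w i)) = x i (w i)` (`StubEmbedding.sum_entry`). Cone factorisations restrict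
to submatrices with the same `(q, r)` (`StubEmbedding.hasConeFact_submatrix`), so a factorisation
of the big matrix with `q + r ≤ n^c` is one of the lift (`StubEmbedding.hasConeFact_lift`), whence
`t^{φ d} ≤ q + r ≤ n^c`; but `n < m (t + 1) ≤ 2 m t` gives `n^c ≤ (2m)^c t^c < t^{c+1} ≤ t^{φ d}`
(`StubEmbedding.pow_lt_div_pow_succ`), a contradiction. The threshold of `ExactLifting` is uniform
in `ε`, which is what makes the argument work for every `ε > 0` at once.
-/

set_option linter.dupNamespace false -- `Summit.PneNP.PneNP.…`: summit = sub-problem (D-0017)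

namespace Summit.PneNP.PneNP.Theorems.XorDoor

open scoped BigOperators Classical
open Filter Finset Matrix

namespace StubEmbedding

variable {m t n : ℕ}

/-! ## §1 The block embedding and the renaming of equations -/

/-- The block embedding: if `m * t ≤ n`, the `m · t` gadget variables `Fin m × Fin t` inject into
`Fin n` (`m` blocks of `t` consecutive variables). [folklore] -/
theorem exists_blockEmb (hmt : m * t ≤ n) : ∃ ι : Fin m × Fin t → Fin n, Function.Injective ι :=
  ⟨fun p => Fin.castLE hmt (finProdFinEquiv p),
    (Fin.castLE_injective hmt).comp finProdFinEquiv.injective⟩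

/-- Along an injective block embedding `ι` and a pointer vector `w`, `i ↦ ι (i, w i)` is injective.
[folklore] -/
theorem ptr_injective {ι : Fin m × Fin t → Fin n} (hι : Function.Injective ι) (w : Fin m → Fin t) :
    Function.Injective fun i : Fin m => ι (i, w i) := fun _ _ h =>
  (Prod.ext_iff.1 (hι h)).1

/-- The renaming of pool equations along `w` — variable `i` of `Pool m` becomes variable
`ι (i, w i)` of `Pool n`, the right-hand side is kept — is injective. [folklore] -/
theorem ren_injective {ι : Fin m × Fin t → Fin n} (hι : Function.Injective ι) (w : Fin m → Fin t) :
    Function.Injective fun e : Pool m =>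
      ((ι (e.1, w e.1), ι (e.2.1, w e.2.1), ι (e.2.2.1, w e.2.2.1), e.2.2.2) : Pool n) := by
  rintro ⟨i, j, l, b⟩ ⟨i', j', l', b'⟩ h
  simp only [Prod.mk.injEq] at h
  obtain ⟨h1, h2, h3, h4⟩ := h
  rw [ptr_injective hι w h1, ptr_injective hι w h2, ptr_injective hι w h3, h4]

/-! ## §2 Rows, columns and the entry identity -/

/-- Rows: the set of ALL pool equations satisfied by an assignment `z` is a satisfiable system, i.e.
a rejected input of `3XOR-UNSAT_n`. [folklore] -/
theorem xor3Unsat_decide_sat (z : Fin n → ZMod 2) :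
    xor3Unsat n (fun e => decide (Sat z e)) = false := by
  unfold xor3Unsat
  rw [decide_eq_false_iff_not, not_not]
  exact ⟨z, fun e he => of_decide_eq_true he⟩

/-- Columns (XOR ∘ Index = XOR): if the renaming `f` of equations is induced by the renaming `g` of
variables (`Sat z (f e) ↔ Sat (z ∘ g) e`), the renamed copy `f(F)` of an unsatisfiable system `F` is
unsatisfiable (a solution pulls back along `g`), i.e. an accepted input of `3XOR-UNSAT_n`.
[folklore] -/
theorem xor3Unsat_decide_mem_map (F : Finset (Pool m))
    (hF : ¬ ∃ y : Fin m → ZMod 2, ∀ e ∈ F, Sat y e) (f : Pool m ↪ Pool n) (g : Fin m → Fin n)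
    (hfg : ∀ (z : Fin n → ZMod 2) (e : Pool m), Sat z (f e) ↔ Sat (fun i => z (g i)) e) :
    xor3Unsat n (fun e => decide (e ∈ F.map f)) = true := by
  unfold xor3Unsat
  rw [decide_eq_true_iff]
  rintro ⟨z, hz⟩
  exact hF ⟨fun i => z (g i), fun e he =>
    (hfg z e).1 (hz (f e) (decide_eq_true (Finset.mem_map_of_mem f he)))⟩

/-- **Entry identity.** With `f`, `g` as above, the equations of `f(F)` not satisfied by `z` are the
renamed equations of `F` violated by `z ∘ g`, so the `(row of z, column f(F))` entry of the
one-sided distance matrix of `3XOR-UNSAT_n` is `viol_F(z ∘ g)`. [folklore] -/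
theorem sum_entry (F : Finset (Pool m)) (f : Pool m ↪ Pool n) (g : Fin m → Fin n)
    (hfg : ∀ (z : Fin n → ZMod 2) (e : Pool m), Sat z (f e) ↔ Sat (fun i => z (g i)) e)
    (z : Fin n → ZMod 2) :
    (∑ e : Pool n,
        if decide (e ∈ F.map f) = true ∧ decide (Sat z e) = false then (1 : ℝ) else 0) =
      (viol F (fun i => z (g i)) : ℝ) := by
  have hfilter : (Finset.univ.filter fun e : Pool n =>
      decide (e ∈ F.map f) = true ∧ decide (Sat z e) = false) =
        (F.filter fun e => ¬ Sat (fun i => z (g i)) e).map f := by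
    ext e
    simp only [Finset.mem_filter, Finset.mem_univ, true_and, Finset.mem_map, decide_eq_true_eq,
      decide_eq_false_iff_not]
    constructor
    · rintro ⟨⟨a, ha, rfl⟩, hns⟩
      exact ⟨a, ⟨ha, fun h => hns ((hfg z a).2 h)⟩, rfl⟩
    · rintro ⟨a, ⟨ha, hns⟩, rfl⟩
      exact ⟨⟨a, ha, rfl⟩, fun h => hns ((hfg z a).1 h)⟩
  rw [Finset.sum_boole, hfilter, Finset.card_map]
  unfold viol
  congr

/-! ## §3 Cone factorisations restrict to submatrices -/

/-- Cone factorisations restrict to submatrices, with the same `(q, r)`. [folklore] -/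
theorem hasConeFact_submatrix {α β α' β' : Type} {M : α → β → ℝ} {q r : ℕ}
    (h : HasConeFact M q r) (f : α' → α) (g : β' → β) :
    HasConeFact (fun a b => M (f a) (g b)) q r := by
  obtain ⟨H, Y, U, V, hH, hY, hU, hV, hM⟩ := h
  exact ⟨fun a => H (f a), fun b => Y (g b), fun a l => U (f a) l, fun l b => V l (g b),
    fun a => hH (f a), fun b => hY (g b), fun a l => hU (f a) l, fun l b => hV l (g b),
    fun a b => hM (f a) (g b)⟩

/-- Abstract form of the lift: rows `row x` (satisfiable systems) and columns `col w` (unsatisfiable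
systems) whose entries in the one-sided distance matrix of `3XOR-UNSAT_n` are `viol_F(x[w])` turn a
`(PSD_q ⊕ ℝ^r_{≥0})`-factorisation of the shifted distance matrix into one of the Index-lift
`(x, w) ↦ viol_F(x[w]) - ε`, with the same `(q, r)`. [folklore] -/
theorem hasConeFact_lift_of (F : Finset (Pool m)) {ε : ℝ} {q r : ℕ}
    (row : (Fin m → Fin t → ZMod 2) → Pool n → Bool) (hrow : ∀ x, xor3Unsat n (row x) = false)
    (col : (Fin m → Fin t) → Pool n → Bool) (hcol : ∀ w, xor3Unsat n (col w) = true)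
    (hentry : ∀ x w, (∑ e : Pool n, if col w e = true ∧ row x e = false then (1 : ℝ) else 0) =
      (viol F (fun i => x i (w i)) : ℝ))
    (h : HasConeFact
      (fun (u : {u : Pool n → Bool // xor3Unsat n u = false})
           (v : {v : Pool n → Bool // xor3Unsat n v = true}) =>
        (∑ e : Pool n, if v.1 e = true ∧ u.1 e = false then (1 : ℝ) else 0) - ε) q r) :
    HasConeFact (fun (x : Fin m → Fin t → ZMod 2) (w : Fin m → Fin t) =>
      (viol F (fun i => x i (w i)) : ℝ) - ε) q r := by
  have key := hasConeFact_submatrix h (fun x => ⟨row x, hrow x⟩) (fun w => ⟨col w, hcol w⟩)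
  simp only [hentry] at key
  exact key

/-- **The lift is a submatrix of the big matrix.** For `m * t ≤ n`, a
`(PSD_q ⊕ ℝ^r_{≥0})`-factorisation of the shifted one-sided distance matrix of `3XOR-UNSAT_n`
restricts to one of the Index-lift `(x, w) ↦ viol_F(x[w]) - ε` with the same `(q, r)`: the row of
`x` is the set of all pool equations satisfied by the `0`-extension `x̃` of `x` along a block
embedding `ι` (`Function.extend`), the column of `w` is `F` renamed along `i ↦ ι (i, w i)`, and the
entry is `viol_F(x[w])` because `x̃ (ι (i, w i)) = x i (w i)`. [folklore] -/
theorem hasConeFact_lift (hmt : m * t ≤ n) (F : Finset (Pool m))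
    (hF : ¬ ∃ y : Fin m → ZMod 2, ∀ e ∈ F, Sat y e) {ε : ℝ} {q r : ℕ}
    (h : HasConeFact
      (fun (u : {u : Pool n → Bool // xor3Unsat n u = false})
           (v : {v : Pool n → Bool // xor3Unsat n v = true}) =>
        (∑ e : Pool n, if v.1 e = true ∧ u.1 e = false then (1 : ℝ) else 0) - ε) q r) :
    HasConeFact (fun (x : Fin m → Fin t → ZMod 2) (w : Fin m → Fin t) =>
      (viol F (fun i => x i (w i)) : ℝ) - ε) q r := by
  obtain ⟨ι, hι⟩ := exists_blockEmb hmt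
  refine hasConeFact_lift_of F
    (fun x e => decide (Sat (Function.extend ι (fun p => x p.1 p.2) 0) e))
    (fun x => xor3Unsat_decide_sat _)
    (fun w e => decide (e ∈ F.map ⟨_, ren_injective hι w⟩))
    (fun w => xor3Unsat_decide_mem_map F hF _ (fun i => ι (i, w i)) fun _ _ => Iff.rfl)
    (fun x w => ?_) h
  rw [sum_entry F ⟨_, ren_injective hι w⟩ (fun i => ι (i, w i)) (fun _ _ => Iff.rfl)]
  simp only [hι.extend_apply]

/-! ## §4 Parameter bookkeeping -/

/-- If `(2m)^c < n / m` (and `m ≥ 1`) then `n^c < (n / m)^(c+1)`: indeed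
`n < m (n/m + 1) ≤ 2 m (n/m)`, so `n^c ≤ (2m)^c (n/m)^c < (n/m)^(c+1)`. [folklore] -/
theorem pow_lt_div_pow_succ {m n c : ℕ} (hm : 0 < m) (h : (2 * m) ^ c < n / m) :
    n ^ c < (n / m) ^ (c + 1) := by
  set t := n / m
  have h0 : 1 ≤ t := (lt_of_le_of_lt (Nat.one_le_pow c (2 * m) (by omega)) h).le
  have h1 : n < m * t + m := by simpa [mul_add_one] using Nat.lt_mul_div_succ n hm
  have h2 : n ≤ 2 * (m * t) := by
    have e2 : m ≤ m * t := Nat.le_mul_of_pos_right m h0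
    omega
  calc n ^ c ≤ (2 * (m * t)) ^ c := Nat.pow_le_pow_left h2 c
    _ = (2 * m) ^ c * t ^ c := by rw [← mul_assoc, mul_pow]
    _ < t * t ^ c := mul_lt_mul_of_pos_right h (pow_pos (by omega) c)
    _ = t ^ (c + 1) := (pow_succ' t c).symm

end StubEmbedding

open StubEmbedding in
/-- **Stub `stub_embedding` of the line `xor-door-perfect-completeness` (XOR ∘ Index = XOR).**
ε-exact lifting for the Index gadget (`ExactLifting`) and one unsatisfiable perfect-completeness
instance per degree (`PerfectCompleteness`) give the canonical cone-rank form of `C⁺`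
(`XorConeRankHardEv`): the Index-lift of `viol_F - ε` at gadget size `t = n / m` is a submatrix of
the shifted one-sided distance matrix of `3XOR-UNSAT_n` (`hasConeFact_lift`), so a cone
factorisation of the latter with `q + r ≤ n^c < t^{c+1} ≤ t^{φ d}` contradicts the lifting bound.
[folklore] -/
theorem stub_embedding : ExactLifting → PerfectCompleteness → XorConeRankHardEv := by
  rintro ⟨φ, hφ, hmain⟩ hPC c
  obtain ⟨d, hd⟩ := hφ (c + 1)
  obtain ⟨m, F, hunsat, hE⟩ := hPC d
  obtain ⟨T, hT⟩ := hmain m d F hunsat hE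
  have hm : 0 < m := Nat.pos_of_ne_zero (by
    rintro rfl
    exact hunsat ⟨fun i => i.elim0, fun e _ => e.1.elim0⟩)
  refine Filter.eventually_atTop.2 ⟨(T + (2 * m) ^ c + 1) * m, fun n hn ε hε q r hqr hfact => ?_⟩
  have ht : T + (2 * m) ^ c + 1 ≤ n / m := (Nat.le_div_iff_mul_le hm).2 hn
  have hmt : m * (n / m) ≤ n := Nat.mul_div_le n m
  have key : (n / m) ^ φ d ≤ q + r :=
    hT (n / m) ε (by omega) hε q r (hasConeFact_lift hmt F hunsat hfact)
  have h1 : n ^ c < (n / m) ^ (c + 1) := pow_lt_div_pow_succ hm (by omega)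
  have h2 : (n / m) ^ (c + 1) ≤ (n / m) ^ φ d := Nat.pow_le_pow_right (by omega) hd
  exact absurd key (not_le.2 (lt_of_le_of_lt hqr (lt_of_lt_of_le h1 h2)))

end Summit.PneNP.PneNP.Theorems.XorDoor
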